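import Summits.Ventures.PercRepro.C041SkeletonCount

/-!
# THEOREM R, the reduction, THE COUNT: `0 ≤ Σ_{S ∈ 𝒮(O)} (3g(S) − 2)` (p6, gen 23)

Setting of `C041SkeletonCount` (mine-3, C-041.md §3 / §6 (d), plan §7).  `srcSet O` = the `(D,A)` sources of the
singleton-attachment family agreeing with `O` on the bare edges; `patOn S` = the pattern of `S` on the port problem
`P = portOf O`.

* `adm_valid_of_mem` — the pattern of a source is admissible and valid; `weight_of_mem` — its weight is `3g(S) − 2`;
* `recolour_mem` — recolouring a source by an admissible valid pattern gives a source (`Sing`, `NoDouble`, the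
  converse dictionary `DA_of_adm`);
* `card_fibre_le` / `card_fibre_eq` — the fibres of `patOn` over the admissible valid patterns have one size;
* **`sum_goodDegree_nonneg_of_bare`** — `0 ≤ Σ_{S ∈ srcSet O} (3·[Good_a S] + 3·[Good_b S] − 2)`: the sum is
  `N · Φ∨ P` and `0 ≤ Φ∨ P` by THE LEMMA (`phiOr_nonneg`; the ports of `P` are reached from `c`).

Hypotheses: a terminal edge exists, `c` is not adjacent to a terminal and differs from both, `a ≠ b`, at most one edge
from a vertex to each terminal (`UniqTerm`).  This is mine-3's «(CC) on `𝒮_sing(O)` for every `O`» (C-041.md §3,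
THEOREM R restricted to singleton attachments) as a tree theorem.
-/

namespace PercRepro

namespace MultiGraph

open Finset PortProblem

variable {V E : Type*} {G : MultiGraph V E}

section Count

variable [Fintype V] (a b c : V) (hc : ∀ e, ¬ G.Joins e c a ∧ ¬ G.Joins e c b)
  (hca : c ≠ a) (hcb : c ≠ b) (hne : a ≠ b) (huniq : G.UniqTerm a b) (habE : ∃ e, G.Joins e a b) (O : Config E)

/-- A source of the singleton family with bare colouring `O`. -/
def IsSrc (G : MultiGraph V E) (a b c : V) (O S : Config E) : Prop :=
  G.AgreeBare a b O S ∧ G.Sing a b S ∧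
    ((G.Conn S c a ∧ G.Conn S c b) ∧ (¬ G.Conn Sᶜ c a ∧ ¬ G.Conn Sᶜ c b ∧ ¬ G.Conn Sᶜ a b))

/-- The pattern of `S` on the port problem of `O`. -/
noncomputable def patOn (S : Config E) : (G.portOf a b c hc O).Term → Bool := fun t => G.pat a b S t.1

/-- The transported pattern is `patOn`. -/
theorem transport_patternOf {S : Config E} (h : G.portOf a b c hc S = G.portOf a b c hc O) :
    (h ▸ G.patternOf a b c hc S : (G.portOf a b c hc O).Term → Bool) = G.patOn a b c hc O S := by
  funext t
  rw [transport_apply h, patternOf_eq_pat]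
  unfold patOn
  rw [transport_term_fst h]

omit [Fintype V] in
/-- Unfolding `IsSrc`. -/
theorem isSrc_iff {S : Config E} : G.IsSrc a b c O S ↔ G.AgreeBare a b O S ∧ G.Sing a b S ∧
    ((G.Conn S c a ∧ G.Conn S c b) ∧ (¬ G.Conn Sᶜ c a ∧ ¬ G.Conn Sᶜ c b ∧ ¬ G.Conn Sᶜ a b)) := Iff.rfl

omit [Fintype V] in
include habE in
/-- The terminal edge is red in a source. -/
theorem terminal_red_of_mem {S : Config E} (hS : G.IsSrc a b c O S) : ∃ e, G.Joins e a b ∧ S e = true := by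
  obtain ⟨e₀, he₀⟩ := habE
  refine ⟨e₀, he₀, ?_⟩
  have hab := ((isSrc_iff a b c O).1 hS).2.2.2.2.2
  cases h : S e₀
  · exact absurd (Conn.of_openAdj ⟨e₀, by rw [compl_apply_not, h]; rfl, he₀⟩) hab
  · rfl

include habE in
/-- **The pattern of a source is admissible and valid.** -/
theorem adm_valid_of_mem {S : Config E} (hS : G.IsSrc a b c O S) :
    (G.portOf a b c hc O).Adm (G.patOn a b c hc O S) ∧
      ((G.portOf a b c hc O).X₁ (G.patOn a b c hc O S) ∨ (G.portOf a b c hc O).X₂ (G.patOn a b c hc O S)) := by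
  obtain ⟨hagree, hsing, hred, hca', hcb', hab'⟩ := (isSrc_iff a b c O).1 hS
  have h := portOf_congr hc hagree
  rw [← transport_patternOf a b c hc O h]
  exact (adm_valid_transport h _).2 (valid_patternOf hc hsing hca' hcb' hab' hred (terminal_red_of_mem a b c habE O hS))

include huniq in
open Classical in
/-- **The weight of the pattern of a source is its Good-degree weight.** -/
theorem weight_of_mem {S : Config E} (hS : G.IsSrc a b c O S) :
    (G.portOf a b c hc O).weight (G.patOn a b c hc O S) =
      (if G.WalkAvoiding S (G.cluster Sᶜ a) c b then 3 else 0) +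
        (if G.WalkAvoiding S (G.cluster Sᶜ b) c a then 3 else 0) - 2 := by
  obtain ⟨hagree, hsing, _, hca', hcb', hab'⟩ := (isSrc_iff a b c O).1 hS
  have h := portOf_congr hc hagree
  rw [← transport_patternOf a b c hc O h, weight_transport h]
  exact weight_patternOf hc hsing huniq hca' hcb' hab'

include hca hcb hne huniq habE in
open Classical in
/-- **Recolouring a source by an admissible valid pattern gives a source.** -/
theorem recolour_mem {S : Config E} (hS : G.IsSrc a b c O S) {x' : (G.portOf a b c hc O).Term → Bool}
    (hadm : (G.portOf a b c hc O).Adm x')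
    (hval : (G.portOf a b c hc O).X₁ x' ∨ (G.portOf a b c hc O).X₂ x') :
    G.IsSrc a b c O (G.recolour hc O x' S) := by
  obtain ⟨hagree, hsing, _, _, _, hab'⟩ := (isSrc_iff a b c O).1 hS
  have hred := terminal_red_of_mem a b c habE O hS
  -- (1) the bare edges are kept
  have hagree' : G.AgreeBare a b O (G.recolour hc O x' S) := by
    intro e he
    rw [recolour_bare hc O x' S he]
    exact hagree e he
  -- (2) the singleton condition
  have hsing' : G.Sing a b (G.recolour hc O x' S) := by
    rintro u ⟨e, hj, hblue⟩ f hf hfu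
    rw [recolour_bare hc O x' S hf]
    have hub : u ≠ a ∧ u ≠ b := by
      refine ⟨fun h => hf.1 (h ▸ hfu), fun h => hf.2 (h ▸ hfu)⟩
    by_cases hterm : ∃ t : (G.portOf a b c hc O).Term, G.Joins e t.1.1 (termEnd hc O t)
    · -- `e` is the edge of a term at the port `u`: the pattern `x′` is blue there, so `u` is switchable
      obtain ⟨t, ht⟩ := hterm
      have htu : t.1.1 = u := port_of_term hc hca hcb O ht hj hub
      rw [recolour_term hc hca hcb O hne x' S ht] at hblue
      have hsw : (G.portOf a b c hc O).sw t.1.1 = true := by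
        by_contra hsw
        have := hadm.1 t (Bool.eq_false_iff.2 hsw)
        rw [this] at hblue
        exact Bool.noConfusion hblue
      rw [htu] at hsw
      have hO := decide_eq_true_iff.1 hsw f hf hfu
      rw [hagree f hf]
      exact hO
    · -- no term: the edge is unchanged, and `Sing S` applies
      rw [recolour_of_not_term hc O x' S hterm] at hblue
      exact hsing u ⟨e, hj, hblue⟩ f hf hfu
  -- (3) no double-blue vertex
  have hnd' : G.NoDouble a b (G.recolour hc O x' S) := by
    rintro u ⟨⟨e₁, hj₁, hb₁⟩, ⟨e₂, hj₂, hb₂⟩⟩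
    have hub : u ≠ a ∧ u ≠ b := by
      constructor
      · intro hua
        -- `e₂` joins `a` and `b`: the terminal edge is red
        rw [hua] at hj₂
        obtain ⟨e₀, he₀, hS₀⟩ := hred
        rw [huniq.2 _ _ _ hj₂ he₀] at hb₂
        have hno : ¬ ∃ t : (G.portOf a b c hc O).Term, G.Joins e₀ t.1.1 (termEnd hc O t) := by
          rintro ⟨t, ht⟩
          have hp := port_ne_terminal hc hca hcb O t.2.1
          unfold termEnd at ht
          rcases ht with ⟨h1, h2⟩ | ⟨h1, h2⟩ <;> rcases he₀ with ⟨h3, h4⟩ | ⟨h3, h4⟩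
          · exact hp.1 (h1.symm.trans h3)
          · exact hp.2 (h1.symm.trans h3)
          · exact hp.2 (h2.symm.trans h4)
          · exact hp.1 (h2.symm.trans h4)
        rw [recolour_of_not_term hc O x' S hno, hS₀] at hb₂
        exact Bool.noConfusion hb₂
      · intro hub'
        rw [hub'] at hj₁
        obtain ⟨e₀, he₀, hS₀⟩ := hred
        rw [huniq.1 _ _ _ hj₁ he₀.symm] at hb₁
        have hno : ¬ ∃ t : (G.portOf a b c hc O).Term, G.Joins e₀ t.1.1 (termEnd hc O t) := by
          rintro ⟨t, ht⟩
          have hp := port_ne_terminal hc hca hcb O t.2.1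
          unfold termEnd at ht
          rcases ht with ⟨h1, h2⟩ | ⟨h1, h2⟩ <;> rcases he₀ with ⟨h3, h4⟩ | ⟨h3, h4⟩
          · exact hp.1 (h1.symm.trans h3)
          · exact hp.2 (h1.symm.trans h3)
          · exact hp.2 (h2.symm.trans h4)
          · exact hp.1 (h2.symm.trans h4)
        rw [recolour_of_not_term hc O x' S hno, hS₀] at hb₁
        exact Bool.noConfusion hb₁
    by_cases hu : u ∈ (G.portOf a b c hc O).M
    · -- a port: the two terms are both blue in `x′`, against admissibility
      have hk₁ : (G.portOf a b c hc O).k₁ u = true := decide_eq_true_iff.2 ⟨e₁, hj₁⟩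
      have hk₂ : (G.portOf a b c hc O).k₂ u = true := decide_eq_true_iff.2 ⟨e₂, hj₂⟩
      let t₁ : (G.portOf a b c hc O).Term := ⟨(u, false), hu, fun _ => hk₁, fun h => Bool.noConfusion h⟩
      let t₂ : (G.portOf a b c hc O).Term := ⟨(u, true), hu, fun h => Bool.noConfusion h, fun _ => hk₂⟩
      have h1 : G.recolour hc O x' S e₁ = x' t₁ := recolour_term hc hca hcb O hne x' S (t := t₁) hj₁
      have h2 : G.recolour hc O x' S e₂ = x' t₂ := recolour_term hc hca hcb O hne x' S (t := t₂) hj₂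
      rcases hadm.2 t₁ t₂ rfl rfl rfl with h | h
      · rw [h1, h] at hb₁
        exact Bool.noConfusion hb₁
      · rw [h2, h] at hb₂
        exact Bool.noConfusion hb₂
    · -- not a port: the edges are unchanged, and the source has no double-blue vertex
      have hno₁ : ¬ ∃ t : (G.portOf a b c hc O).Term, G.Joins e₁ t.1.1 (termEnd hc O t) := by
        rintro ⟨t, ht⟩
        exact hu ((port_of_term hc hca hcb O ht (Or.inl hj₁) hub) ▸ t.2.1)
      have hno₂ : ¬ ∃ t : (G.portOf a b c hc O).Term, G.Joins e₂ t.1.1 (termEnd hc O t) := by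
        rintro ⟨t, ht⟩
        exact hu ((port_of_term hc hca hcb O ht (Or.inr hj₂) hub) ▸ t.2.1)
      rw [recolour_of_not_term hc O x' S hno₁] at hb₁
      rw [recolour_of_not_term hc O x' S hno₂] at hb₂
      exact hab' ((Conn.of_openAdj ⟨e₁, by rw [compl_apply_not, hb₁]; rfl, hj₁.symm⟩).trans
        (Conn.of_openAdj ⟨e₂, by rw [compl_apply_not, hb₂]; rfl, hj₂⟩))
  -- (4) the terminal edge stays red
  have hab'' : ∀ e, G.Joins e a b → G.recolour hc O x' S e = true := by
    intro e he
    have hno : ¬ ∃ t : (G.portOf a b c hc O).Term, G.Joins e t.1.1 (termEnd hc O t) := by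
      rintro ⟨t, ht⟩
      have hp := port_ne_terminal hc hca hcb O t.2.1
      unfold termEnd at ht
      rcases ht with ⟨h1, h2⟩ | ⟨h1, h2⟩ <;> rcases he with ⟨h3, h4⟩ | ⟨h3, h4⟩
      · exact hp.1 (h1.symm.trans h3)
      · exact hp.2 (h1.symm.trans h3)
      · exact hp.2 (h2.symm.trans h4)
      · exact hp.1 (h2.symm.trans h4)
    rw [recolour_of_not_term hc O x' S hno]
    obtain ⟨e₀, he₀, hS₀⟩ := hred
    rw [huniq.2 _ _ _ he he₀]
    exact hS₀
  -- (5) the validity of the recoloured pattern, transported to its own port problem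
  have h := portOf_congr hc hagree'
  have hpat : (h ▸ G.patternOf a b c hc (G.recolour hc O x' S) : (G.portOf a b c hc O).Term → Bool) = x' := by
    rw [transport_patternOf a b c hc O h]
    funext t
    exact pat_recolour hc hca hcb O hne huniq x' S t
  have hval' := (adm_valid_transport h (G.patternOf a b c hc (G.recolour hc O x' S))).1
    (by rw [hpat]; exact ⟨hadm, hval⟩)
  exact (isSrc_iff a b c O).2 ⟨hagree', hsing',
    DA_of_adm hc hsing' hnd' hne hab'' habE hval'.2⟩

end Count

section Sum

variable [Fintype V] [Fintype E] [DecidableEq E] (a b c : V) (hc : ∀ e, ¬ G.Joins e c a ∧ ¬ G.Joins e c b)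
  (hca : c ≠ a) (hcb : c ≠ b) (hne : a ≠ b) (huniq : G.UniqTerm a b) (habE : ∃ e, G.Joins e a b) (O : Config E)

open Classical in
/-- The sources of the singleton family with bare colouring `O`, as a finite set. -/
noncomputable def srcSet : Finset (Config E) := univ.filter fun S : Config E => G.IsSrc a b c O S

open Classical in
/-- The fibre of a pattern. -/
noncomputable def fibre (x : (G.portOf a b c hc O).Term → Bool) : Finset (Config E) :=
  (G.srcSet a b c O).filter fun S => G.patOn a b c hc O S = x

open Classical in
/-- Membership in a fibre. -/
theorem mem_fibre {x : (G.portOf a b c hc O).Term → Bool} {S : Config E} :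
    S ∈ G.fibre a b c hc O x ↔ G.IsSrc a b c O S ∧ G.patOn a b c hc O S = x := by
  unfold fibre srcSet
  simp only [mem_filter, mem_univ, true_and]

omit [Fintype E] [DecidableEq E] in
include hca hcb hne huniq in
/-- The pattern of a recoloured configuration. -/
theorem patOn_recolour (x' : (G.portOf a b c hc O).Term → Bool) (S : Config E) :
    G.patOn a b c hc O (G.recolour hc O x' S) = x' := by
  funext t
  exact pat_recolour hc hca hcb O hne huniq x' S t

omit [Fintype E] [DecidableEq E] in
include hca hcb hne huniq in
/-- Recolouring by the own pattern is the identity (`patOn` form). -/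
theorem recolour_patOn (S : Config E) : G.recolour hc O (G.patOn a b c hc O S) S = S :=
  recolour_self hc hca hcb O hne huniq S

include hca hcb hne huniq habE in
open Classical in
/-- **The fibres of two admissible valid patterns have the same size** (one direction). -/
theorem card_fibre_le {x x' : (G.portOf a b c hc O).Term → Bool}
    (hx' : (G.portOf a b c hc O).Adm x' ∧ ((G.portOf a b c hc O).X₁ x' ∨ (G.portOf a b c hc O).X₂ x')) :
    (G.fibre a b c hc O x).card ≤ (G.fibre a b c hc O x').card := by
  refine card_le_card_of_injOn (G.recolour hc O x') ?_ ?_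
  · intro S hS
    rw [coe_fibre_mem] at hS ⊢
    exact ⟨recolour_mem a b c hc hca hcb hne huniq habE O hS.1 hx'.1 hx'.2,
      patOn_recolour a b c hc hca hcb hne huniq O x' S⟩
  · intro S₁ hS₁ S₂ hS₂ heq
    rw [coe_fibre_mem] at hS₁ hS₂
    have h := congrArg (G.recolour hc O x) heq
    rw [recolour_recolour hc hca hcb O hne x x' S₁, recolour_recolour hc hca hcb O hne x x' S₂] at h
    have h1 : G.recolour hc O x S₁ = S₁ := by
      rw [← hS₁.2]
      exact recolour_patOn a b c hc hca hcb hne huniq O S₁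
    have h2 : G.recolour hc O x S₂ = S₂ := by
      rw [← hS₂.2]
      exact recolour_patOn a b c hc hca hcb hne huniq O S₂
    rw [h1, h2] at h
    exact h
where
  coe_fibre_mem {x : (G.portOf a b c hc O).Term → Bool} {S : Config E} :
      S ∈ (↑(G.fibre a b c hc O x) : Set (Config E)) ↔ G.IsSrc a b c O S ∧ G.patOn a b c hc O S = x := by
    rw [Finset.mem_coe]
    exact mem_fibre a b c hc O

include hca hcb hne huniq habE in
open Classical in
/-- **The fibres of two admissible valid patterns have the same size.** -/
theorem card_fibre_eq {x x' : (G.portOf a b c hc O).Term → Bool}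
    (hx : (G.portOf a b c hc O).Adm x ∧ ((G.portOf a b c hc O).X₁ x ∨ (G.portOf a b c hc O).X₂ x))
    (hx' : (G.portOf a b c hc O).Adm x' ∧ ((G.portOf a b c hc O).X₁ x' ∨ (G.portOf a b c hc O).X₂ x')) :
    (G.fibre a b c hc O x).card = (G.fibre a b c hc O x').card :=
  le_antisymm (card_fibre_le a b c hc hca hcb hne huniq habE O hx')
    (card_fibre_le a b c hc hca hcb hne huniq habE O hx)

include habE in
open Classical in
/-- The fibre of a pattern that is not admissible and valid is empty. -/
theorem fibre_eq_empty {x : (G.portOf a b c hc O).Term → Bool}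
    (hx : ¬ ((G.portOf a b c hc O).Adm x ∧ ((G.portOf a b c hc O).X₁ x ∨ (G.portOf a b c hc O).X₂ x))) :
    G.fibre a b c hc O x = ∅ := by
  rw [Finset.eq_empty_iff_forall_notMem]
  intro S hS
  rw [mem_fibre] at hS
  apply hx
  rw [← hS.2]
  exact adm_valid_of_mem a b c hc habE O hS.1

omit [Fintype E] [DecidableEq E] in
/-- The ports of the port problem of `O` are reached from `c`. -/
theorem portOf_ports_reachable : ∀ q ∈ (G.portOf a b c hc O).M,
    Relation.ReflTransGen (G.portOf a b c hc O).adj (G.portOf a b c hc O).c q := by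
  intro q hq
  exact ((mem_portM hc).1 hq).1

include hc hca hcb hne huniq habE in
open Classical in
/-- **THE COUNT**: `0 ≤ Σ_{S ∈ srcSet O} (3·[Good_a S] + 3·[Good_b S] − 2)` — mine-3's «(CC) on `𝒮_sing(O)`»
(C-041.md §3, THEOREM R restricted to singleton attachments), from THE LEMMA `phiOr_nonneg`. -/
theorem sum_goodDegree_nonneg_of_bare :
    0 ≤ ∑ S ∈ G.srcSet a b c O,
      ((if G.WalkAvoiding S (G.cluster Sᶜ a) c b then (3 : ℤ) else 0) +
        (if G.WalkAvoiding S (G.cluster Sᶜ b) c a then 3 else 0) - 2) := by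
  set P := G.portOf a b c hc O with hP
  -- the weights are the pattern weights
  have hw : ∀ S ∈ G.srcSet a b c O,
      ((if G.WalkAvoiding S (G.cluster Sᶜ a) c b then (3 : ℤ) else 0) +
        (if G.WalkAvoiding S (G.cluster Sᶜ b) c a then 3 else 0) - 2) = P.weight (G.patOn a b c hc O S) := by
    intro S hS
    unfold srcSet at hS
    rw [mem_filter] at hS
    exact (weight_of_mem a b c hc huniq O hS.2).symm
  rw [Finset.sum_congr rfl hw, ← Finset.sum_fiberwise (G.srcSet a b c O) (G.patOn a b c hc O)]
  -- each fibre contributes its size times the pattern weight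
  have hfib : ∀ x : P.Term → Bool,
      ∑ S ∈ (G.srcSet a b c O).filter (fun S => G.patOn a b c hc O S = x), P.weight (G.patOn a b c hc O S) =
        (G.fibre a b c hc O x).card • P.weight x := by
    intro x
    rw [← Finset.sum_const]
    apply Finset.sum_congr rfl
    intro S hS
    rw [mem_filter] at hS
    rw [hS.2]
  simp only [hfib]
  by_cases hex : ∃ x₀ : P.Term → Bool, P.Adm x₀ ∧ (P.X₁ x₀ ∨ P.X₂ x₀)
  · obtain ⟨x₀, hx₀⟩ := hex
    -- every fibre has the size of `fibre x₀` on the admissible valid patterns, and is empty elsewhere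
    have hcard : ∀ x : P.Term → Bool, (G.fibre a b c hc O x).card • P.weight x =
        ((G.fibre a b c hc O x₀).card : ℤ) * (if P.Adm x ∧ (P.X₁ x ∨ P.X₂ x) then P.weight x else 0) := by
      intro x
      by_cases hx : P.Adm x ∧ (P.X₁ x ∨ P.X₂ x)
      · rw [if_pos hx, card_fibre_eq a b c hc hca hcb hne huniq habE O hx hx₀, nsmul_eq_mul]
      · rw [if_neg hx, fibre_eq_empty a b c hc habE O hx, card_empty, zero_smul, mul_zero]
    simp only [hcard]
    rw [← Finset.mul_sum]
    apply mul_nonneg (Nat.cast_nonneg _)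
    exact Problem.phiOr_nonneg P (portOf_ports_reachable a b c hc O)
  · -- no admissible valid pattern: every fibre is empty
    apply Finset.sum_nonneg
    intro x _
    have hx : ¬ (P.Adm x ∧ (P.X₁ x ∨ P.X₂ x)) := fun h => hex ⟨x, h⟩
    rw [fibre_eq_empty a b c hc habE O hx, card_empty, zero_smul]

end Sum

end MultiGraph

end PercRepro
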